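import Mathlib
import HarnessLib.Audit
import Summits.PneNP.PneNP.Theorems.PstarPinGap

/-!
# The two-query rung and the mixed pin rung of the gap lemma (ROUND-24, items T24.18(h=2) / T24.21)

FRONTIER range-avoidance ladder, rung F-N3, ROUND 24 (cell `pnp-ideate`, planner seat p3; restricted-model proof complexity —
nothing here bears on `P` versus `NP`).

State of the ladder under the crux `PstarGapLemma.PstarGapLemmaSO` (`|J| ≤ K(Δ)·|W|` for minimal `W`-infeasible output sets of
expanding typed pure-`P⋆` instances with simple overlaps and variable degree `≤ Δ`):
* `|W| ≤ 1` is SETTLED with `K = 0` (`PstarGSat.pstarGapOne`, T24.12, via `GSat`);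
* constraints of support size `≤ d` are SETTLED with `|J| ≤ 2d|W|` (`PstarGapSupport.card_le_of_sparse`; unit pins: `PstarPinGapProof.pinGap`,
  T24.20) — so the whole difficulty sits in WIDE parities reading the private XOR tips of many outputs;
* two tip-reading parities already force `K(Δ) ≥ Δ²/2 - O(Δ)`: the reader cluster (readers `ρ_{pq} = (p,q;·,·)`, `p ∈ P`, `q ∈ Q`,
  `|P| = |Q| = Δ`, `W = {Σ_P a = 0, Σ tips = Σ y + 1}`) is minimal infeasible with `|J| = Δ²`, `|W| = 2` (memo ROUND-24-PRESEED §13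
  R10(q)); it is hereditarily boundary-expanding and has simple overlaps.

This file types the next two rungs.
* `GapTwo` (T24.18 at `h = 2`, OPEN): `|W| ≤ 2 ⇒ |J| ≤ K(Δ)`.  Its reader-only sub-case is `PstarGapTwoReaders.GapTwoReaders`
  (`≤ 64Δ²`, T24.19).  Mechanisms a proof must cover (memo R10(v)–(z), kit K10/K11 censuses j300300/j300951/j301787): TENSOR (the
  cluster: `w₁` AND-linear, `w₂` reads a product of two linear forms, `Θ(Δ²)`), ACTIVATION (`w₁` through readers forces `a_q·L = 1`,
  `O(Δ)`), CLAUSE (`w₁` turns a free closing into a 2-clause `a_u ∨ a_v` read by `O(1)` readers; needs multiplier degree `3` in the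
  Nullstellensatz certificate — so no "degree-2 certificate" shortcut), and chains of these through shared closings (the `(7,3)` instance
  of j301787: two XOR-triangles sharing an edge).  Conjecture: `K(Δ) = Δ²/2 + O(Δ)`.
* `MixedPinGap` (T24.21, OPEN): unit pins plus ONE arbitrary parity `⇒ |J| ≤ K₁(Δ)·(#pins + 1)`.  The form "`2·#pins + K₁(Δ)`" is FALSE:
  pins `a_p = 0 (p ∈ P)` plus one reader-sum parity reproduce the path-core cluster of memo R10(v) with `|J| ≈ Δ·#pins`.  This rung
  isolates the ACTIVATION/CLAUSE mechanisms (pins = literals already derived) from the TENSOR one and is the induction step suggested by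
  the self-similarity of memo R10(z) (a clause read at level `h` is a pin system at level `h+1`).
Both follow from the crux (`gapTwo_of_gapSO`, `mixedPinGap_of_gapSO`).
-/

set_option linter.dupNamespace false

open Finset Literature.Computability.Complexity
open Summit.PneNP.PneNP.Theorems.PstarTyped (Typed)
open Summit.PneNP.PneNP.Theorems.PstarSALevel (BoundaryExpanding SimpleOverlap)
open Summit.PneNP.PneNP.Theorems.PstarGapLemma (MinInfeasible GapBound MaxDegree PstarGapLemmaSO)
open Summit.PneNP.PneNP.Theorems.PstarPinGap (UnitPins)

namespace Summit.PneNP.PneNP.Theorems.PstarGapTwo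

/-- **T24.18 (h = 2) — the two-query rung (OPEN).**  On expanding typed pure-`P⋆` instances with simple overlaps and variable degree
`≤ Δ`, a minimal infeasible output set under at most TWO parity constraints has size at most `K(Δ)` (necessarily `K(Δ) ≥ Δ²/2 - O(Δ)`,
reader cluster).  FRONTIER. -/
@[conjecture] def GapTwo : Prop :=
  ∀ Δ : ℕ, ∃ K : ℕ, ∀ (n m r : ℕ) (I : LocalMap 4 n m), I.IsPure xorAndPred → Typed I → BoundaryExpanding r I →
    SimpleOverlap I → MaxDegree Δ I → ∀ (y : Fin m → Bool) (W : Finset (Finset (Fin n) × Bool)) (J : Finset (Fin m)),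
      W.card ≤ 2 → J.card ≤ r → MinInfeasible I y W J → J.card ≤ K

/-- **T24.21 — the mixed pin rung (OPEN).**  Unit pins `W` (on variables that are nobody's XOR slot) plus ONE further arbitrary parity
constraint `w`: a minimal infeasible output set has size at most `K₁(Δ)·(|W| + 1)`.  FRONTIER. -/
@[conjecture] def MixedPinGap : Prop :=
  ∀ Δ : ℕ, ∃ K : ℕ, ∀ (n m r : ℕ) (I : LocalMap 4 n m), I.IsPure xorAndPred → Typed I → BoundaryExpanding r I →
    SimpleOverlap I → MaxDegree Δ I → ∀ (y : Fin m → Bool) (W : Finset (Finset (Fin n) × Bool)) (w : Finset (Fin n) × Bool)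
      (J : Finset (Fin m)), UnitPins I W → J.card ≤ r → MinInfeasible I y (insert w W) J → J.card ≤ K * (W.card + 1)

/-- The two-query rung follows from the crux. -/
theorem gapTwo_of_gapSO (h : PstarGapLemmaSO) : GapTwo := by
  intro Δ
  obtain ⟨K, _, hK⟩ := h Δ
  refine ⟨K * 2, fun n m r I hI hT hB hS hD y W J hW hJ hmin => ?_⟩
  have h1 : J.card ≤ K * W.card := hK n m r I hI hT hB hS hD y W J hJ hmin
  calc J.card ≤ K * W.card := h1
    _ ≤ K * 2 := Nat.mul_le_mul_left K hW

/-- The mixed pin rung follows from the crux. -/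
theorem mixedPinGap_of_gapSO (h : PstarGapLemmaSO) : MixedPinGap := by
  intro Δ
  obtain ⟨K, _, hK⟩ := h Δ
  refine ⟨K, fun n m r I hI hT hB hS hD y W w J _ hJ hmin => ?_⟩
  have h1 : J.card ≤ K * (insert w W).card := hK n m r I hI hT hB hS hD y (insert w W) J hJ hmin
  calc J.card ≤ K * (insert w W).card := h1
    _ ≤ K * (W.card + 1) := Nat.mul_le_mul_left K (Finset.card_insert_le w W)

/-- `GapTwo` contains the single-query rung's conclusion shape: with `|W| ≤ 1` it gives a bound too (of course `PstarGSat.pstarGapOne`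
gives the sharp `K = 0`; this is only the monotonicity of the rungs). -/
theorem gapOne_shape_of_gapTwo (h : GapTwo) :
    ∀ Δ : ℕ, ∃ K : ℕ, ∀ (n m r : ℕ) (I : LocalMap 4 n m), I.IsPure xorAndPred → Typed I → BoundaryExpanding r I →
      SimpleOverlap I → MaxDegree Δ I → ∀ (y : Fin m → Bool) (W : Finset (Finset (Fin n) × Bool)) (J : Finset (Fin m)),
        W.card ≤ 1 → J.card ≤ r → MinInfeasible I y W J → J.card ≤ K := by
  intro Δ
  obtain ⟨K, hK⟩ := h Δ
  exact ⟨K, fun n m r I hI hT hB hS hD y W J hW hJ hmin => hK n m r I hI hT hB hS hD y W J (hW.trans (by norm_num)) hJ hmin⟩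

end Summit.PneNP.PneNP.Theorems.PstarGapTwo
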